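import Literature.AnabelianGeometry.AbsoluteAnabelian.MonoidKummerTransportCanonical
import Literature.AnabelianGeometry.AbsoluteAnabelian.MonoidKummerModelCompactProofs
import Literature.AnabelianGeometry.AbsoluteAnabelian.GaloisCyclotomeZHatOne
import Literature.AnabelianGeometry.AbsoluteAnabelian.MonoidKummerMapsTLGLiftTransport
import Literature.AnabelianGeometry.EtaleTheta.KummerFunctorialityCovariantIso

/-!
# [AbsTopIII] Prop 3.2 (ii), coefficient replacement `μ_Ẑ(M_TM) ↦ μ_Ẑ(G)`: the model Kummer maps with
# values in `H¹(H, μ_Ẑ(G_k))` for the GROUP-THEORETIC cyclotome `μ_Ẑ(G_k)` (junction, row P32.ii.L11)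

S. Mochizuki, *Topics in absolute anabelian geometry III*, §3, Prop. 3.2 (ii) p. 71 l. 61 – p. 72 l. 6 (bib
key `MochizukiAbsTopIII2015`; kurims pages, lit key `paper:url-5493eb38cbb7`): "… the Kummer maps
`M^H_TM → H¹(H, μ_Ẑ(M_TM))` … — where … the «`μ_Ẑ(M_TM)`» may be replaced by «`μ_Ẑ(G)`» [cf. Remark 3.2.1
below] or (when `(Π ↷ M_TM)` is of hyperbolic orbicurve type) by «`μ_Ẑ(Π)`» [cf. Corollary 1.10, (c)] or
«`μ^κ_Ẑ(Π)`» [cf. Remark 1.10.3, (ii)]", Rmk. 3.2.1 p. 73 ("a functorial algorithm for constructing the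
natural isomorphism `μ_Ẑ(M_TM) ⥲ μ_Ẑ(G)`").

JUNCTION FILE (sub-DAG row P32.ii.L11 of `plan/L4/SUBDAG-AbsTopIII-Prop32.md`; abc-iut-L4-lead RULING
#5y «P32ii-L11-COEFF»).  Inputs, all REAL objects of the tree: abc-iut-L4-t2's model Kummer theory
`ModelMLFGaloisData.kummerTheory` (Kummer classes in `H¹(H, Λ(k̄ˣ))`, `MonoidKummerModel.lean`);
abc-iut-L4-t1's group-theoretic cyclotome `muZhat G_k = Λ(μ_{ℚ/ℤ}(G_k))` (`GaloisCyclotome.lean`) with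
its `G_k`-action; the PROVED identification `TorsionReciprocityData.muZhatEquiv : μ_Ẑ(G_k) ⥲ Λ(k̄ˣ)`,
`G_k`-equivariant (`GaloisCyclotomeZHatOne.lean`, p420801; reciprocity data exist unconditionally for every
non-archimedean local field of characteristic `0`, `nonempty_torsionReciprocityData`); independence of the
algebraic closure (`algEquivContinuousMulEquivAbsoluteGaloisGroup`, `smul_algEquiv…`).  For model data
`(k, k̄, ε_k : Π_k ↠ G_k)` over ANY closure `k̄` (`MLFClosure`):

* `ModelMLFGaloisData.augGal : Π_k →* G_k := Gal(k^alg/k)` (continuous) and the equivariant CO-morphism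
  `cycCoMorphism R : (G_k ↷ μ_{ℚ/ℤ}(G_k)) ⇝ (Π_k ↷ k̄ˣ)` (`EtaleTheta.CoMorphism`: `Π_k → G_k` and the
  `G_k`-equivariant injection `μ_{ℚ/ℤ}(G_k) ↪ k̄ˣ` of reciprocity data `R`, read in `k̄` through
  `k̄ ≃ k^alg`);
* `muZhatRep R H : Rep ℤ H` — the coefficients `μ_Ẑ(G_k)` on an open `H ⊆ Π_k` (acting through `ε_k`), and
  **`coeffIso R H : H¹(H, μ_Ẑ(G_k)) ≅ H¹(H, Λ(k̄ˣ))`** = `H¹(H, Rmk. 3.2.1)` (Mathlib `groupCohomology.mapIso`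
  along the bijective `Λ(μ_{ℚ/ℤ}(G_k) ↪ k̄ˣ) = muZhatEquiv`);
* **`kummerMuZhat R H : (𝒪_k̄^⊳)^H → H¹(H, μ_Ẑ(G_k))`** — the Kummer map with `μ_Ẑ(G)`-coefficients — with
  `coeffIso_hom_kummerMuZhat` (it IS `κ_H` read through Rmk. 3.2.1), `kummerMuZhat_mul`,
  `kummerMuZhat_injective_of_isOpen` / `kummerMuZhat_injective` (Kummer-faithfulness transfers);
* the `μ_Ẑ(Π)`-replacement in COVERED form: `kummerCoeff ι` for ANY isomorphism of `H`-modules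
  `ι : μ_Ẑ(G_k)|_H ≅ N` — the intended `ι` is the cyclotomic synchronization `μ_Ẑ(G_k) ⥲ μ_Ẑ(Π_X) = M_X` of
  Cor. 1.10 (c), in the tree the NAMED FACT `AbsTopIII.CurveModel.Cor_1_10_ii_c` (relative to a
  `CurveModel`); so that half reads «sync-iso ⟹ Kummer map with `μ_Ẑ(Π)`-coefficients, injective», and is
  COVERED, not discharged here.

Universe `0` (Mathlib `groupCohomology`).  HONEST FRAMING: local class field theory + Kummer theory as
proved in the tree; the `μ_Ẑ(G_k)`-valued maps depend on the reciprocity datum `R` exactly as print's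
«natural isomorphism» depends on local class field theory; nothing here bears on [IUTchIII] Cor. 3.12.
-/

noncomputable section

namespace Literature.AnabelianGeometry.AbsoluteAnabelian

open _root_.CategoryTheory groupCohomology
open Literature.AnabelianGeometry.EtaleTheta (kummerClass invariants cyclotomeRep CoMorphism)
open Literature.NumberTheory.GaloisRepresentations (algEquivContinuousMulEquivAbsoluteGaloisGroup)

section Model

variable (C : MLFClosure.{0}) (D : ModelMLFGaloisData C.k C.K) (R : TorsionReciprocityData C.k)

namespace MLFClosure

/-- The identification `k̄ ≃ₐ[k] k^alg` of the closure of the datum with Mathlib's `AlgebraicClosure k`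
(`IsAlgClosure.equiv`). [cite: MochizukiAbsTopIII2015, Definition 3.1 (i) p.66] -/
abbrev toAlgClosure : C.K ≃ₐ[C.k] AlgebraicClosure C.k := IsAlgClosure.equiv C.k C.K (AlgebraicClosure C.k)

end MLFClosure

namespace ModelMLFGaloisData

/-- **`ε_k` followed by `Aut_k(k̄) ⥲ G_k = Gal(k^alg/k)`**: `Π_k →* G_k` into Mathlib's absolute Galois group
(independence of the algebraic closure, `algEquivContinuousMulEquivAbsoluteGaloisGroup`).
[cite: MochizukiAbsTopIII2015, Definition 3.1 (i) p.66] -/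
def augGal : D.Pi →* Field.absoluteGaloisGroup C.k :=
  (algEquivContinuousMulEquivAbsoluteGaloisGroup C.k C.K).toMonoidHom.comp D.aug

/-- `augGal` is continuous. [cite: MochizukiAbsTopIII2015, Definition 3.1 (i) p.66] -/
theorem continuous_augGal : Continuous (D.augGal C) :=
  (algEquivContinuousMulEquivAbsoluteGaloisGroup C.k C.K).continuous.comp D.continuous_aug

/-- How `augGal g` acts on `k^alg`: transport of `ε_k(g)` along `k̄ ≃ k^alg`.
[cite: MochizukiAbsTopIII2015, Definition 3.1 (i) p.66] -/
theorem augGal_smul (g : D.Pi) (z : AlgebraicClosure C.k) :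
    D.augGal C g • z = C.toAlgClosure (D.aug g (C.toAlgClosure.symm z)) :=
  Literature.AnabelianGeometry.AbsoluteAnabelian.smul_algEquivContinuousMulEquivAbsoluteGaloisGroup
    C.k C.K (D.aug g) z

/-- **The roots of unity of `G_k` in `k̄ˣ`**: `μ_{ℚ/ℤ}(G_k) ⥲ (k^algˣ)_tors ⊆ k^algˣ ≃ k̄ˣ` (reciprocity data `R`,
then `k^alg ≃ k̄`), as a homomorphism `Multiplicative μ_{ℚ/ℤ}(G_k) →* k̄ˣ`.
[cite: MochizukiAbsTopIII2015, Remark 3.2.1 p.73] -/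
def rootsHom : Multiplicative (muQZ (Field.absoluteGaloisGroup C.k)) →* (C.K)ˣ :=
  (Units.map (C.toAlgClosure.symm : AlgebraicClosure C.k →* C.K)).comp
    ((CommGroup.torsion (AlgebraicClosure C.k)ˣ).subtype.comp
      (AddEquiv.toMultiplicativeLeft R.equiv).toMonoidHom)

/-- `rootsHom` on elements, read in `k̄`. [cite: MochizukiAbsTopIII2015, Remark 3.2.1 p.73] -/
theorem coe_rootsHom (z : Multiplicative (muQZ (Field.absoluteGaloisGroup C.k))) :
    ((rootsHom C R z : (C.K)ˣ) : C.K) =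
      C.toAlgClosure.symm (((Additive.toMul (R.equiv (Multiplicative.toAdd z)) :
        CommGroup.torsion (AlgebraicClosure C.k)ˣ) : (AlgebraicClosure C.k)ˣ) : AlgebraicClosure C.k) :=
  rfl

/-- `rootsHom` is injective. [cite: MochizukiAbsTopIII2015, Remark 3.2.1 p.73] -/
theorem rootsHom_injective : Function.Injective (rootsHom C R) := by
  intro z w h
  have h1 := congrArg (fun u : (C.K)ˣ => C.toAlgClosure (u : C.K)) h
  simp only [coe_rootsHom, AlgEquiv.apply_symm_apply] at h1
  have h2 : (Additive.toMul (R.equiv (Multiplicative.toAdd z)) : CommGroup.torsion (AlgebraicClosure C.k)ˣ) =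
      Additive.toMul (R.equiv (Multiplicative.toAdd w)) := Subtype.ext (Units.ext h1)
  have h3 := R.equiv.injective (Additive.toMul.injective h2)
  exact Multiplicative.toAdd.injective h3

/-- **Equivariance**: `rootsHom (augGal γ • z) = γ • rootsHom z` — the `G_k`-equivariance of the reciprocity
identification (`TorsionReciprocityData.equiv_smul`, [AbsAnab] Prop. 1.2.1 (vi)) transported to `k̄`.
[cite: MochizukiAbsTopIII2015, Remark 3.2.1 p.73] -/
theorem rootsHom_smul (γ : D.Pi) (z : Multiplicative (muQZ (Field.absoluteGaloisGroup C.k))) :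
    rootsHom C R (D.augGal C γ • z) = γ • rootsHom C R z := by
  apply Units.ext
  rw [units_coe_smul, coe_rootsHom, coe_rootsHom]
  have hz : Multiplicative.toAdd (D.augGal C γ • z) = D.augGal C γ • Multiplicative.toAdd z :=
    muQZ.toAdd_smul _ _
  rw [hz, R.equiv_smul, augGal_smul, AlgEquiv.symm_apply_apply, AlgEquiv.smul_def]

/-- **The equivariant co-morphism `(G_k ↷ μ_{ℚ/ℤ}(G_k)) ⇝ (Π_k ↷ k̄ˣ)`** (`EtaleTheta.CoMorphism`: `Π_k → G_k`
contravariantly, `μ_{ℚ/ℤ}(G_k) ↪ k̄ˣ` covariantly). [cite: MochizukiAbsTopIII2015, Remark 3.2.1 p.73] -/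
def cycCoMorphism :
    CoMorphism (Field.absoluteGaloisGroup C.k) (Multiplicative (muQZ (Field.absoluteGaloisGroup C.k)))
      D.Pi (C.K)ˣ where
  groupHom := D.augGal C
  map := rootsHom C R
  map_smul := rootsHom_smul C D R

/-- `Λ(rootsHom) : μ_Ẑ(G_k) = Λ(μ_{ℚ/ℤ}(G_k)) → Λ(k̄ˣ)` is `muZhatEquiv` followed by `Λ(k^algˣ ≃ k̄ˣ)`.
[cite: MochizukiAbsTopIII2015, Remark 3.2.1 p.73] -/
theorem map_rootsHom_eq (ζ : muZhat (Field.absoluteGaloisGroup C.k)) :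
    EtaleTheta.cyclotome.map (rootsHom C R) ζ =
      EtaleTheta.cyclotome.map (Units.map (C.toAlgClosure.symm : AlgebraicClosure C.k →* C.K))
        (R.muZhatEquiv ζ) :=
  Subtype.ext (funext fun _ => rfl)

/-- `Λ(rootsHom)` is bijective (Rmk. 3.2.1: `μ_Ẑ(G_k) ⥲ μ_Ẑ(k̄ˣ) = Ẑ(1)`).
[cite: MochizukiAbsTopIII2015, Remark 3.2.1 p.73] -/
theorem map_rootsHom_bijective : Function.Bijective (EtaleTheta.cyclotome.map (rootsHom C R)) := by
  have h : (EtaleTheta.cyclotome.map (rootsHom C R) : muZhat (Field.absoluteGaloisGroup C.k) →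
        EtaleTheta.cyclotome (C.K)ˣ) =
      EtaleTheta.cyclotome.map (Units.map (C.toAlgClosure.symm : AlgebraicClosure C.k →* C.K)) ∘
        R.muZhatEquiv :=
    funext (map_rootsHom_eq C R)
  rw [h]
  exact (EtaleTheta.cyclotome.map_bijective_of_bijective _
    (Units.mapEquiv (C.toAlgClosure.symm : AlgebraicClosure C.k ≃* C.K)).bijective).comp R.muZhatEquiv.bijective

/-- **The coefficients `μ_Ẑ(G_k)` on an open `H ⊆ Π_k`** (acting through `Π_k → G_k`), as a `ℤ`-linear
`H`-representation: `μ_Ẑ(G_k) = Λ(μ_{ℚ/ℤ}(G_k))` restricted along `augGal| : H → G_k`.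
[cite: MochizukiAbsTopIII2015, Proposition 3.2 (ii) p.72] -/
abbrev muZhatRep (H : Subgroup D.Pi) : Rep ℤ H :=
  Rep.res ((cycCoMorphism C D R).groupHomRestrict (le_top : H.map (D.augGal C) ≤ ⊤))
    (cyclotomeRep (A := Multiplicative (muQZ (Field.absoluteGaloisGroup C.k)))
      (⊤ : Subgroup (Field.absoluteGaloisGroup C.k)))

/-- **Rmk. 3.2.1 on coefficients**: `μ_Ẑ(G_k)|_H ⟶ Λ(k̄ˣ)|_H`, the `H`-equivariant map `Λ(rootsHom)`
(`CoMorphism.cyclotomeHom`). [cite: MochizukiAbsTopIII2015, Remark 3.2.1 p.73] -/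
abbrev coeffHom (H : Subgroup D.Pi) : muZhatRep C D R H ⟶ cyclotomeRep (A := (C.K)ˣ) H :=
  (cycCoMorphism C D R).cyclotomeHom (le_top : H.map (D.augGal C) ≤ ⊤)

/-- **`H¹(H, μ_Ẑ(G_k)) ≅ H¹(H, Λ(k̄ˣ))`** — `H¹` of Rmk. 3.2.1 (Mathlib `groupCohomology.mapIso` along `id_H` with
the bijective coefficient map `Λ(rootsHom)`). [cite: MochizukiAbsTopIII2015, Remark 3.2.1 p.73] -/
def coeffIso (H : Subgroup D.Pi) : H1 (muZhatRep C D R H) ≅ H1 (cyclotomeRep (A := (C.K)ˣ) H) :=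
  groupCohomology.mapIso (A := cyclotomeRep (A := (C.K)ˣ) H) (B := muZhatRep C D R H) (MulEquiv.refl H)
    (LinearEquiv.ofBijective (coeffHom C D R H).hom.toLinearMap (map_rootsHom_bijective C R))
    (fun g => by
      ext v
      exact (cycCoMorphism C D R).cyclotome_map_smul (g : D.Pi) (Additive.toMul v)) 1

/-- The forward map of `coeffIso` is `H¹(id_H, Λ(rootsHom))`. [cite: MochizukiAbsTopIII2015, Remark 3.2.1 p.73] -/
theorem coeffIso_hom (H : Subgroup D.Pi) :
    (coeffIso C D R H).hom = groupCohomology.map (MonoidHom.id H) (coeffHom C D R H) 1 := by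
  change groupCohomology.map _ _ 1 = groupCohomology.map _ _ 1
  refine groupCohomology.map_congr ?_ ?_ 1
  · exact MonoidHom.ext fun _ => rfl
  · exact LinearMap.ext fun _ => rfl

/-- **The Kummer map with `μ_Ẑ(G)`-coefficients** `(𝒪_k̄^⊳)^H → H¹(H, μ_Ẑ(G_k))` ([AbsTopIII] Prop. 3.2 (ii):
«`μ_Ẑ(M_TM)` may be replaced by `μ_Ẑ(G)` [cf. Remark 3.2.1]»): the model Kummer class read through
`coeffIso⁻¹`. [cite: MochizukiAbsTopIII2015, Proposition 3.2 (ii) p.72] -/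
def kummerMuZhat (H : OpenSubgroup D.tmPair.Pi)
    (m : {m : D.tmPair.M // ∀ h : H, (h : D.tmPair.Pi) • m = m}) :
    H1 (muZhatRep C D R (H : Subgroup D.Pi)) :=
  (coeffIso C D R (H : Subgroup D.Pi)).inv ((D.kummerTheory C).kummer H m)

/-- `coeffIso (kummerMuZhat m) = κ_H(m)`: the `μ_Ẑ(G)`-valued Kummer map IS the Kummer map of Prop. 3.2 (ii)
read through Rmk. 3.2.1. [cite: MochizukiAbsTopIII2015, Proposition 3.2 (ii) p.72] -/
@[simp] theorem coeffIso_hom_kummerMuZhat (H : OpenSubgroup D.tmPair.Pi)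
    (m : {m : D.tmPair.M // ∀ h : H, (h : D.tmPair.Pi) • m = m}) :
    (coeffIso C D R (H : Subgroup D.Pi)).hom (kummerMuZhat C D R H m) = (D.kummerTheory C).kummer H m :=
  Iso.inv_hom_id_apply (coeffIso C D R (H : Subgroup D.Pi)) _

/-- Multiplicativity: `κ^G_H(m m') = κ^G_H(m) + κ^G_H(m')`. [cite: MochizukiAbsTopIII2015, Proposition 3.2 (ii) p.72] -/
theorem kummerMuZhat_mul (H : OpenSubgroup D.tmPair.Pi)
    (m m' : {m : D.tmPair.M // ∀ h : H, (h : D.tmPair.Pi) • m = m}) :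
    kummerMuZhat C D R H ⟨m.1 * m'.1, fun h => by rw [smul_mul', m.2 h, m'.2 h]⟩ =
      kummerMuZhat C D R H m + kummerMuZhat C D R H m' := by
  have h := (D.kummerTheory C).kummer_mul H m m'
  change (coeffIso C D R (H : Subgroup D.Pi)).inv ((D.kummerTheory C).kummer H _) =
    (coeffIso C D R (H : Subgroup D.Pi)).inv ((D.kummerTheory C).kummer H m) +
      (coeffIso C D R (H : Subgroup D.Pi)).inv ((D.kummerTheory C).kummer H m')
  rw [h]
  exact map_add _ _ _

/-- **Kummer-faithfulness transfers**: the `μ_Ẑ(G)`-valued Kummer map is injective at every open `H ⊆ Π_k`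
with open image in `G_k` (`ModelMLFGaloisData.kummer_injective_of_isOpen` + `coeffIso`).
[cite: MochizukiAbsTopIII2015, Proposition 3.2 (ii) p.72] -/
theorem kummerMuZhat_injective_of_isOpen (H : OpenSubgroup D.tmPair.Pi)
    (hH : IsOpen ((((H : Subgroup D.Pi).map D.aug : Subgroup (C.K ≃ₐ[C.k] C.K)) :
      Set (C.K ≃ₐ[C.k] C.K)))) :
    Function.Injective (kummerMuZhat C D R H) := by
  intro m m' h
  have h' := congrArg (coeffIso C D R (H : Subgroup D.Pi)).hom h
  rw [coeffIso_hom_kummerMuZhat, coeffIso_hom_kummerMuZhat] at h'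
  exact D.kummer_injective_of_isOpen C H hH h'

/-- In particular for `ε_k` an open map (e.g. `Π_k` profinite) the `μ_Ẑ(G)`-valued Kummer map is injective
at every open `H`. [cite: MochizukiAbsTopIII2015, Proposition 3.2 (ii) p.72] -/
theorem kummerMuZhat_injective (hε : IsOpenMap D.aug) (H : OpenSubgroup D.tmPair.Pi) :
    Function.Injective (kummerMuZhat C D R H) :=
  kummerMuZhat_injective_of_isOpen C D R H (by
    rw [Subgroup.coe_map]
    exact hε _ H.isOpen)

/-! ### The `μ_Ẑ(Π)`-replacement, COVERED form -/

/-- **Coefficient replacement along an isomorphism of `H`-modules** `ι : μ_Ẑ(G_k)|_H ≅ N` — for `N = μ_Ẑ(Π_X)`,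
`ι =` the cyclotomic synchronization of Cor. 1.10 (c) (tree: the NAMED FACT
`AbsTopIII.CurveModel.Cor_1_10_ii_c`, relative to a `CurveModel`): the Kummer map
`(𝒪_k̄^⊳)^H → H¹(H, N)`, `m ↦ H¹(ι)(κ^G_H(m))` ("«`μ_Ẑ(M_TM)`» may be replaced … by «`μ_Ẑ(Π)`» [cf.
Corollary 1.10, (c)]").  COVERED, not discharged: the synchronization isomorphism is an input.
[cite: MochizukiAbsTopIII2015, Proposition 3.2 (ii) p.72] -/
def kummerCoeff (H : OpenSubgroup D.tmPair.Pi) {N : Rep ℤ (H : Subgroup D.Pi)}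
    (ι : muZhatRep C D R (H : Subgroup D.Pi) ≅ N)
    (m : {m : D.tmPair.M // ∀ h : H, (h : D.tmPair.Pi) • m = m}) : H1 N :=
  (groupCohomology.functor ℤ (H : Subgroup D.Pi) 1).map ι.hom (kummerMuZhat C D R H m)

/-- The replaced Kummer map is injective whenever the `μ_Ẑ(G)`-valued one is (e.g. under
`kummerMuZhat_injective`): «sync-iso ⟹ injective Kummer map with `μ_Ẑ(Π)`-coefficients».
[cite: MochizukiAbsTopIII2015, Proposition 3.2 (ii) p.72] -/
theorem kummerCoeff_injective (H : OpenSubgroup D.tmPair.Pi) {N : Rep ℤ (H : Subgroup D.Pi)}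
    (ι : muZhatRep C D R (H : Subgroup D.Pi) ≅ N) (hinj : Function.Injective (kummerMuZhat C D R H)) :
    Function.Injective (kummerCoeff C D R H ι) :=
  (ConcreteCategory.bijective_of_isIso ((groupCohomology.functor ℤ (H : Subgroup D.Pi) 1).map ι.hom)).1.comp
    hinj

/-- For compact `Π_k` the `μ_Ẑ(G)`-valued Kummer map is injective at every open `H`
(`isOpenMap_aug_of_compactSpace`). [cite: MochizukiAbsTopIII2015, Proposition 3.2 (ii) p.72] -/
theorem kummerMuZhat_injective_of_compactSpace [CompactSpace D.Pi] (H : OpenSubgroup D.tmPair.Pi) :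
    Function.Injective (kummerMuZhat C D R H) :=
  kummerMuZhat_injective C D R D.isOpenMap_aug_of_compactSpace H

end ModelMLFGaloisData

end Model

/-! ### Abstract MLF-Galois `TM`-pairs: the `μ_Ẑ(G)`-valued Kummer maps of a model presentation -/

namespace GaloisMonoidPair.ModelPresentation

variable {P : GaloisMonoidPair.{0}} (π : P.ModelPresentation) (R : TorsionReciprocityData π.C.k)

/-- **The Kummer map with `μ_Ẑ(G)`-coefficients of an ABSTRACT MLF-Galois `TM`-pair** `(Π ↷ M)` presented by
`π = (k, k̄, Π_k ↠ G_k, e)`: at an open `H ⊆ Π`, `M^H → H¹(e⁻¹H, μ_Ẑ(G_k))`, `m ↦ κ^G_{e⁻¹H}(e⁻¹ m)` — the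
`μ_Ẑ(G)`-coefficient form of `π.kummerTheory.kummer` (whose carrier is `H¹(e⁻¹H, Λ(k̄ˣ))`).
[cite: MochizukiAbsTopIII2015, Proposition 3.2 (ii) p.72] -/
def kummerMuZhat (H : OpenSubgroup P.Pi) (m : {m : P.M // ∀ h : H, (h : P.Pi) • m = m}) :
    H1 (ModelMLFGaloisData.muZhatRep π.C π.D R ((π.comapOpen H : OpenSubgroup π.D.tmPair.Pi) : Subgroup π.D.Pi)) :=
  ModelMLFGaloisData.kummerMuZhat π.C π.D R (π.comapOpen H)
    ⟨π.iso.isoM.symm m.1, fun g => π.iso.smul_symm_eq_of_mem_comap m.2 g⟩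

/-- Read through `H¹(e⁻¹H, Rmk. 3.2.1)`, `π.kummerMuZhat` IS `π.kummerTheory.kummer`.
[cite: MochizukiAbsTopIII2015, Proposition 3.2 (ii) p.72] -/
theorem coeffIso_hom_kummerMuZhat (H : OpenSubgroup P.Pi) (m : {m : P.M // ∀ h : H, (h : P.Pi) • m = m}) :
    (ModelMLFGaloisData.coeffIso π.C π.D R ((π.comapOpen H : OpenSubgroup π.D.tmPair.Pi) : Subgroup π.D.Pi)).hom
        (π.kummerMuZhat R H m) = π.kummerTheory.kummer H m :=
  ModelMLFGaloisData.coeffIso_hom_kummerMuZhat π.C π.D R (π.comapOpen H) _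

/-- Injectivity at every open `H` when `ε_k` is open. [cite: MochizukiAbsTopIII2015, Proposition 3.2 (ii) p.72] -/
theorem kummerMuZhat_injective (hε : IsOpenMap π.D.aug) (H : OpenSubgroup P.Pi) :
    Function.Injective (π.kummerMuZhat R H) := by
  intro m m' h
  have h' := ModelMLFGaloisData.kummerMuZhat_injective π.C π.D R hε (π.comapOpen H) h
  have h'' : π.iso.isoM.symm m.1 = π.iso.isoM.symm m'.1 := congrArg Subtype.val h'
  exact Subtype.ext (π.iso.isoM.symm.injective h'')

/-- Injectivity at every open `H` for COMPACT `Π` (e.g. profinite, the case of print).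
[cite: MochizukiAbsTopIII2015, Proposition 3.2 (ii) p.72] -/
theorem kummerMuZhat_injective_of_compactSpace [CompactSpace P.Pi] (H : OpenSubgroup P.Pi) :
    Function.Injective (π.kummerMuZhat R H) := by
  haveI : CompactSpace π.D.tmPair.Pi := π.iso.isoPi.toHomeomorph.symm.compactSpace
  exact π.kummerMuZhat_injective R π.D.isOpenMap_aug_of_compactSpace H

end GaloisMonoidPair.ModelPresentation

/-! ### Unconditional existence forms -/

/-- **[AbsTopIII] Prop 3.2 (ii) with `μ_Ẑ(G)`-coefficients, unconditionally at the model**: for model data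
`(k, k̄, ε_k : Π_k ↠ G_k)` of an MLF with `ε_k` open, there are reciprocity data `R` (local class field
theory, `nonempty_torsionReciprocityData`) and hence, at every open `H ⊆ Π_k`, an INJECTIVE Kummer map
`(𝒪_k̄^⊳)^H → H¹(H, μ_Ẑ(G_k))` whose image under `H¹(H, Rmk. 3.2.1) : H¹(H, μ_Ẑ(G_k)) ⥲ H¹(H, Λ(k̄ˣ))` is the
Kummer map of Prop. 3.2 (ii). [cite: MochizukiAbsTopIII2015, Proposition 3.2 (ii) p.72] -/
theorem exists_kummerMuZhat (C : MLFClosure.{0}) (D : ModelMLFGaloisData C.k C.K) (hε : IsOpenMap D.aug) :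
    ∃ R : TorsionReciprocityData C.k, ∀ H : OpenSubgroup D.tmPair.Pi,
      Function.Injective (ModelMLFGaloisData.kummerMuZhat C D R H) ∧
        ∀ m, (ModelMLFGaloisData.coeffIso C D R (H : Subgroup D.Pi)).hom
          (ModelMLFGaloisData.kummerMuZhat C D R H m) = (D.kummerTheory C).kummer H m := by
  obtain ⟨R⟩ := nonempty_torsionReciprocityData C.k
  exact ⟨R, fun H => ⟨ModelMLFGaloisData.kummerMuZhat_injective C D R hε H, fun m =>
    ModelMLFGaloisData.coeffIso_hom_kummerMuZhat C D R H m⟩⟩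

/-- **[AbsTopIII] Prop 3.2 (ii) with `μ_Ẑ(G)`-coefficients on every ABSTRACT MLF-Galois `TM`-pair with compact
`Π`**: given any model presentation `π`, there are reciprocity data `R` for `k` such that at every open
`H ⊆ Π` the `μ_Ẑ(G_k)`-valued Kummer map `M^H → H¹(e⁻¹H, μ_Ẑ(G_k))` is INJECTIVE and is carried by
`H¹(Rmk. 3.2.1)` onto `π.kummerTheory.kummer H`. [cite: MochizukiAbsTopIII2015, Proposition 3.2 (ii) p.72] -/
theorem GaloisMonoidPair.ModelPresentation.exists_kummerMuZhat {P : GaloisMonoidPair.{0}} [CompactSpace P.Pi]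
    (π : P.ModelPresentation) :
    ∃ R : TorsionReciprocityData π.C.k, ∀ H : OpenSubgroup P.Pi,
      Function.Injective (π.kummerMuZhat R H) ∧
        ∀ m, (ModelMLFGaloisData.coeffIso π.C π.D R
            ((π.comapOpen H : OpenSubgroup π.D.tmPair.Pi) : Subgroup π.D.Pi)).hom (π.kummerMuZhat R H m) =
          π.kummerTheory.kummer H m := by
  obtain ⟨R⟩ := nonempty_torsionReciprocityData π.C.k
  exact ⟨R, fun H => ⟨π.kummerMuZhat_injective_of_compactSpace R H, fun m => π.coeffIso_hom_kummerMuZhat R H m⟩⟩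

end Literature.AnabelianGeometry.AbsoluteAnabelian

end
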